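import Summits.KontsevichZagierPeriods.Zeta5Search.Barrier.ConeGammaCuspSlopeConvexity

/-!
# ζ(5) search — BARRIER: THE TRANSPORT FORM OF THE CUSP SLOPE — first-order response = finitely many pair exchanges

HONEST FRAMING (cell `pub-zeta5`): systematic search; no irrationality claim unless kernel-certified. MODEL objects
under Brown–Zudilin's (28)+(30) accounting ([BZ22] = arXiv:2210.03391; (28) observed, not proved); nothing here is a
statement about `ζ(5)`, any `γ` of record, the cone's supremum (C2 OPEN) or the VALUE / SIGN of the cusp slope, its
weights or its exchange pairs at a named direction (DATA of the cell); S-E stays CONJECTURED; records in print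
UNMOVED. Prover P2 g30, item «THE JUNCTION VOTE IS A LOVÁSZ EXTENSION» (INBOX 2026-08-27), file (5) = P2 g29's
successor menu (b), the transport form.

* **`exists_transport`** — an integer vector `J ∈ ℤ²⁸` with `Σ J = 0`, `J ≥ 0` on `F`, `J ≤ 0` off `F` is a TRANSPORT:
  `J_k = Σ_l w_{kl}` (`k ∈ F`), `J_l = −Σ_k w_{kl}` (`l ∉ F`) with `w_{kl} ∈ ℕ` supported on `F × F^c` (greedy
  matching, induction on `Σ_F J`);
* **`cuspSlope_eq_transport`** — for EVERY displacement `δ`: `σ(δ') = Σ_{k∈F, l∉F} w_{kl}·(φ_k(δ')/h_k − φ_l(δ')/h_l)` on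
  the closed chamber of a generic `δ₀ ∋ δ`, `w ∈ ℕ^{F×F^c}`, with total mass `Σ w_{kl} ≤ T·Σ_{k∈F} h_k(a) =
  T·(2s₀ + 4Σ_j s_j)` (`sum_FIdx_h28`): to first order the saving responds to a displacement by finitely many PAIR
  EXCHANGES of an `F`-flip against an `F^c`-flip; a pair raises `σ` iff its `F`-member flips FIRST
  (`φ_k/h_k > φ_l/h_l`).
NOT here: which pairs carry weight at a named direction (DATA); `γ`, C2, S-E, `ζ(5)`.
-/

noncomputable section

open Set MeasureTheory Finset
open scoped Topology

namespace Summit.KontsevichZagierPeriods.Zeta5Search.Barrier.ConeGamma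

/-! ### Oriented integer vectors with zero sum are transports -/

/-- **TRANSPORT DECOMPOSITION.** An integer vector on `Fin 28` with zero sum, `≥ 0` on `F` and `≤ 0` off `F`, is a
non-negative integer combination of the elementary exchanges `e_k − e_l`, `k ∈ F`, `l ∉ F`. -/
theorem exists_transport (J : Fin 28 → ℤ) (hsum : ∑ k, J k = 0) (hF : ∀ k, k ∈ FIdx → 0 ≤ J k)
    (hFc : ∀ k, k ∉ FIdx → J k ≤ 0) :
    ∃ w : Fin 28 → Fin 28 → ℕ, (∀ k l, w k l ≠ 0 → k ∈ FIdx ∧ l ∉ FIdx) ∧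
      (∀ k, k ∈ FIdx → J k = ∑ l, (w k l : ℤ)) ∧ (∀ l, l ∉ FIdx → J l = -∑ k, (w k l : ℤ)) := by
  classical
  -- induction on the transported mass `Σ_{k∈F} J_k`
  suffices h : ∀ n : ℕ, ∀ J : Fin 28 → ℤ, ∑ k, J k = 0 → (∀ k, k ∈ FIdx → 0 ≤ J k) →
      (∀ k, k ∉ FIdx → J k ≤ 0) → ∑ k ∈ FIdx, J k ≤ n →
      ∃ w : Fin 28 → Fin 28 → ℕ, (∀ k l, w k l ≠ 0 → k ∈ FIdx ∧ l ∉ FIdx) ∧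
        (∀ k, k ∈ FIdx → J k = ∑ l, (w k l : ℤ)) ∧ (∀ l, l ∉ FIdx → J l = -∑ k, (w k l : ℤ)) by
    obtain ⟨n, hn⟩ : ∃ n : ℕ, ∑ k ∈ FIdx, J k ≤ n :=
      ⟨(∑ k ∈ FIdx, J k).toNat, Int.self_le_toNat _⟩
    exact h n J hsum hF hFc hn
  intro n
  induction n with
  | zero =>
    intro J hsum hF hFc hle
    -- all weights vanish
    have hF0 : ∀ k, k ∈ FIdx → J k = 0 := fun k hk => by
      have h1 := Finset.sum_eq_zero_iff_of_nonneg (s := FIdx) (f := J) (fun i hi => hF i hi)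
      have h0 : ∑ k ∈ FIdx, J k = 0 := le_antisymm (by exact_mod_cast hle) (Finset.sum_nonneg fun i hi => hF i hi)
      exact h1.mp h0 k hk
    have hFc0 : ∀ k, k ∉ FIdx → J k = 0 := fun k hk => by
      have hsplit := Finset.sum_add_sum_compl FIdx J
      rw [hsum, Finset.sum_eq_zero fun i hi => hF0 i hi, zero_add] at hsplit
      have h1 := Finset.sum_eq_zero_iff_of_nonpos (s := FIdxᶜ) (f := J)
        (fun i hi => hFc i (Finset.mem_compl.mp hi))
      exact h1.mp hsplit k (Finset.mem_compl.mpr hk)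
    refine ⟨fun _ _ => 0, fun k l h => absurd rfl h, fun k hk => ?_, fun l hl => ?_⟩
    · rw [hF0 k hk]; simp
    · rw [hFc0 l hl]; simp
  | succ n ih =>
    intro J hsum hF hFc hle
    by_cases hall : ∀ k, k ∈ FIdx → J k = 0
    · exact ih J hsum hF hFc (by rw [Finset.sum_eq_zero fun i hi => hall i hi]; exact_mod_cast Nat.zero_le n)
    push Not at hall
    obtain ⟨k₀, hk₀, hJk₀⟩ := hall
    have hpos₀ : 0 < J k₀ := lt_of_le_of_ne (hF k₀ hk₀) (Ne.symm hJk₀)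
    -- some `F^c` weight is negative
    have hsplit := Finset.sum_add_sum_compl FIdx J
    rw [hsum] at hsplit
    have hFpos : 0 < ∑ k ∈ FIdx, J k :=
      lt_of_lt_of_le hpos₀ (Finset.single_le_sum (fun i hi => hF i hi) hk₀)
    obtain ⟨l₀, hl₀', hJl₀⟩ : ∃ l₀ ∈ FIdxᶜ, J l₀ < 0 := by
      by_contra hno
      push Not at hno
      have : 0 ≤ ∑ k ∈ FIdxᶜ, J k := Finset.sum_nonneg hno
      linarith
    have hl₀ : l₀ ∉ FIdx := Finset.mem_compl.mp hl₀'
    have hkl : k₀ ≠ l₀ := fun h => hl₀ (h ▸ hk₀)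
    -- move one unit from `k₀` to `l₀`
    let J' : Fin 28 → ℤ := fun i => J i - (if i = k₀ then 1 else 0) + (if i = l₀ then 1 else 0)
    have hJ'sum : ∑ k, J' k = 0 := by
      simp only [J', Finset.sum_add_distrib, Finset.sum_sub_distrib, Finset.sum_ite_eq', Finset.mem_univ,
        if_true, hsum]; ring
    have hJ'F : ∀ k, k ∈ FIdx → 0 ≤ J' k := fun k hk => by
      have hkl₀ : k ≠ l₀ := fun h : k = l₀ => hl₀ (h ▸ hk)
      simp only [J']
      by_cases h1 : k = k₀
      · rw [if_pos h1, if_neg hkl₀]; rw [h1]; linarith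
      · rw [if_neg h1, if_neg hkl₀]; linarith [hF k hk]
    have hJ'Fc : ∀ k, k ∉ FIdx → J' k ≤ 0 := fun k hk => by
      have hkk₀ : k ≠ k₀ := fun h : k = k₀ => hk (h ▸ hk₀)
      simp only [J']
      by_cases h1 : k = l₀
      · rw [if_pos h1, if_neg hkk₀]; rw [h1]; linarith
      · rw [if_neg h1, if_neg hkk₀]; linarith [hFc k hk]
    have hJ'le : ∑ k ∈ FIdx, J' k ≤ n := by
      have : ∑ k ∈ FIdx, J' k = ∑ k ∈ FIdx, J k - 1 := by
        simp only [J', Finset.sum_add_distrib, Finset.sum_sub_distrib, Finset.sum_ite_eq', if_pos hk₀,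
          if_neg hl₀]; ring
      rw [this]; push_cast at hle ⊢; linarith
    obtain ⟨w', hw'supp, hw'F, hw'Fc⟩ := ih J' hJ'sum hJ'F hJ'Fc hJ'le
    -- add the exchange `(k₀, l₀)`
    obtain ⟨u, hu⟩ : ∃ u : Fin 28 → Fin 28 → ℕ, ∀ k l, u k l = if k = k₀ then (if l = l₀ then 1 else 0) else 0 :=
      ⟨_, fun _ _ => rfl⟩
    have hu_row : ∀ k, ∑ l, (u k l : ℤ) = if k = k₀ then 1 else 0 := fun k => by
      by_cases h1 : k = k₀
      · rw [if_pos h1, Finset.sum_eq_single l₀ (fun l _ hl => by rw [hu, if_pos h1, if_neg hl]; simp)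
          (fun h => absurd (Finset.mem_univ _) h), hu, if_pos h1, if_pos rfl]; simp
      · rw [if_neg h1, Finset.sum_eq_zero fun l _ => by rw [hu, if_neg h1]; simp]
    have hu_col : ∀ l, ∑ k, (u k l : ℤ) = if l = l₀ then 1 else 0 := fun l => by
      rw [Finset.sum_eq_single k₀ (fun k _ hk => by rw [hu, if_neg hk]; simp)
        (fun h => absurd (Finset.mem_univ _) h), hu, if_pos rfl]
      by_cases h1 : l = l₀
      · rw [if_pos h1, if_pos h1]; simp
      · rw [if_neg h1, if_neg h1]; simp
    refine ⟨fun k l => w' k l + u k l, fun k l h => ?_, fun k hk => ?_, fun l hl => ?_⟩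
    · by_cases hw : w' k l = 0
      · have h' : u k l ≠ 0 := by intro hu0; exact h (by simp only [hw, hu0])
        rw [hu] at h'
        by_cases h1 : k = k₀
        · by_cases h2 : l = l₀
          · rw [h1, h2]; exact ⟨hk₀, hl₀⟩
          · rw [if_pos h1, if_neg h2] at h'; exact absurd rfl h'
        · rw [if_neg h1] at h'; exact absurd rfl h'
      · exact hw'supp k l hw
    · have e := hw'F k hk
      have hkl₀ : k ≠ l₀ := fun h : k = l₀ => hl₀ (h ▸ hk)
      simp only [J'] at e
      rw [if_neg hkl₀, add_zero] at e
      push_cast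
      rw [Finset.sum_add_distrib, hu_row k, ← e]
      ring
    · have e := hw'Fc l hl
      have hlk₀ : l ≠ k₀ := fun h : l = k₀ => hl (h ▸ hk₀)
      simp only [J'] at e
      rw [if_neg hlk₀, sub_zero] at e
      push_cast
      rw [Finset.sum_add_distrib, hu_col l, neg_add, ← e]
      ring

/-! ### The transport form of the cusp slope -/

/-- **THE TRANSPORT FORM OF THE CUSP SLOPE.** For all 28 forms of `a` positive, `T > 0` a period and EVERY
displacement `δ`: there are a generic `δ₀` refining `δ` and exchange weights `w_{kl} ∈ ℕ`, supported on `F × F^c`,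
of total mass `Σ w_{kl} ≤ T·Σ_{k∈F} h_k(a) = T·(2s₀ + 4Σ_j s_j)`, such that
`cuspSlope a T δ' = Σ_k Σ_l w_{kl}·(φ_k(δ')/h_k(a) − φ_l(δ')/h_l(a))` for every `δ'` refined by `δ₀`, in particular at `δ`:
the first-order response of the saving is a finite sum of PAIR EXCHANGES (an `F`-flip against an `F^c`-flip); a pair
contributes positively iff its `F`-member flips first. -/
theorem cuspSlope_eq_transport {a : Dir} (hpos : ∀ k, 0 < h28 a k) {T : ℝ} (hT : 0 < T)
    (hper : ∀ k : Fin 28, ∃ z : ℤ, T * h28 a k = z) (δ : Fin 8 → ℝ) :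
    ∃ δ₀ : Fin 8 → ℝ, (∀ k l : Fin 28, k ≠ l → phiForm δ₀ k / h28 a k ≠ phiForm δ₀ l / h28 a l) ∧
      (∀ k l : Fin 28, phiForm δ k / h28 a k < phiForm δ l / h28 a l →
        phiForm δ₀ k / h28 a k < phiForm δ₀ l / h28 a l) ∧
      ∃ w : Fin 28 → Fin 28 → ℕ, (∀ k l, w k l ≠ 0 → k ∈ FIdx ∧ l ∉ FIdx) ∧
        (∑ k, ∑ l, (w k l : ℝ)) ≤ T * (2 * sParam a 0 + 4 * ∑ j : Fin 7, sParam a j.succ) ∧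
        (∀ δ' : Fin 8 → ℝ, (∀ k l : Fin 28, phiForm δ' k / h28 a k < phiForm δ' l / h28 a l →
            phiForm δ₀ k / h28 a k < phiForm δ₀ l / h28 a l) →
          cuspSlope a T δ' = ∑ k, ∑ l, (w k l : ℝ) * (phiForm δ' k / h28 a k - phiForm δ' l / h28 a l)) ∧
        cuspSlope a T δ = ∑ k, ∑ l, (w k l : ℝ) * (phiForm δ k / h28 a k - phiForm δ l / h28 a l) := by
  classical
  obtain ⟨δ₀, hgen, href, 𝒥, h0, hF, hFc, hlin, -⟩ := cuspSlope_eq_intLinear_bounded hpos hT hper δ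
  obtain ⟨w, hsupp, hwF, hwFc⟩ := exists_transport 𝒥 h0 (fun k hk => (hF k hk).1) (fun k hk => (hFc k hk).2)
  -- the transport form on the chamber
  have hform : ∀ δ' : Fin 8 → ℝ, (∀ k l : Fin 28, phiForm δ' k / h28 a k < phiForm δ' l / h28 a l →
      phiForm δ₀ k / h28 a k < phiForm δ₀ l / h28 a l) →
      cuspSlope a T δ' = ∑ k, ∑ l, (w k l : ℝ) * (phiForm δ' k / h28 a k - phiForm δ' l / h28 a l) := by
    intro δ' href'
    obtain ⟨r, hr⟩ : ∃ r : Fin 28 → ℝ, ∀ k, r k = phiForm δ' k / h28 a k := ⟨_, fun _ => rfl⟩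
    rw [hlin δ' href']
    simp only [← hr]
    -- `𝒥_k` as signed row/column sums of `w`, valid for all `k` by the support condition
    have hrow : ∀ k, (𝒥 k : ℝ) = ∑ l, (w k l : ℝ) - ∑ l, (w l k : ℝ) := by
      intro k
      by_cases hk : k ∈ FIdx
      · have e : (𝒥 k : ℝ) = ∑ l, (w k l : ℝ) := by exact_mod_cast hwF k hk
        have z : ∑ l, (w l k : ℝ) = 0 := Finset.sum_eq_zero fun l _ => by
          have : w l k = 0 := by by_contra h; exact (hsupp l k h).2 hk
          rw [this]; simp
        rw [e, z, sub_zero]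
      · have e : (𝒥 k : ℝ) = -∑ l, (w l k : ℝ) := by exact_mod_cast hwFc k hk
        have z : ∑ l, (w k l : ℝ) = 0 := Finset.sum_eq_zero fun l _ => by
          have : w k l = 0 := by by_contra h; exact hk (hsupp k l h).1
          rw [this]; simp
        rw [e, z, zero_sub]
    have hL : ∑ k, (𝒥 k : ℝ) * r k = ∑ k, ∑ l, (w k l : ℝ) * r k - ∑ k, ∑ l, (w l k : ℝ) * r k := by
      rw [← Finset.sum_sub_distrib]
      refine Finset.sum_congr rfl fun k _ => ?_
      rw [hrow, sub_mul, Finset.sum_mul, Finset.sum_mul]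
    have hR : ∑ k, ∑ l, (w k l : ℝ) * (r k - r l) =
        ∑ k, ∑ l, (w k l : ℝ) * r k - ∑ k, ∑ l, (w k l : ℝ) * r l := by
      rw [← Finset.sum_sub_distrib]
      refine Finset.sum_congr rfl fun k _ => ?_
      rw [← Finset.sum_sub_distrib]
      exact Finset.sum_congr rfl fun l _ => by ring
    have hswap : ∑ k, ∑ l, (w l k : ℝ) * r k = ∑ k, ∑ l, (w k l : ℝ) * r l := Finset.sum_comm
    rw [hL, hR, hswap]
  refine ⟨δ₀, hgen, href, w, hsupp, ?_, hform, hform δ href⟩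
  -- the total mass
  rw [← sum_FIdx_h28, Finset.mul_sum]
  have hmass : ∑ k, ∑ l, (w k l : ℝ) = ∑ k ∈ FIdx, (𝒥 k : ℝ) := by
    rw [← Finset.sum_add_sum_compl FIdx (fun k => ∑ l, (w k l : ℝ))]
    have z : ∑ k ∈ FIdxᶜ, ∑ l, (w k l : ℝ) = 0 := Finset.sum_eq_zero fun k hk =>
      Finset.sum_eq_zero fun l _ => by
        have : w k l = 0 := by by_contra h; exact (Finset.mem_compl.mp hk) (hsupp k l h).1
        rw [this]; simp
    rw [z, add_zero]
    exact Finset.sum_congr rfl fun k hk => by exact_mod_cast (hwF k hk).symm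
  rw [hmass]
  exact Finset.sum_le_sum fun k hk => (hF k hk).2

end Summit.KontsevichZagierPeriods.Zeta5Search.Barrier.ConeGamma

end
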